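import Literature.Computability.QuantumComplexity.ForrelationThm25Asm
import HarnessLib

/-!
# Aaronson–Ambainis Theorem 25 in `FP`, IV: prefix, tail, header; the whole machine is in `FP`

Topic `Literature/Computability/QuantumComplexity`; fourth file towards the residual named fact
`AaronsonAmbainis2018_thm25_sign_encodeFP` (`ForrelationThm25Sign.lean`; S. Aaronson,
A. Ambainis, *Forrelation*, SIAM J. Comput. 47 (2018) = arXiv:1411.5729, §6, Thm. 25 and its
proof, p. 27). Around the gate loop of `ForrelationThm25Asm.lean` the structured stack program
`Thm25Asm.prog` has

* a **prefix** phase: read the unary numeral `1ⁿ` off the lexed stream (`prefixLoop`), compute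
  the parity of `n` and the padded count `n' = n + padCount n` in unary (`parityLoop`, `padStep`),
  and the binary numerals of the two dummy wires `n'`, `n' + 1` and of `N = n' + 2`
  (`mkDummies`, by the increment `incR`);
* the gate loop;
* a **tail** phase (`tailProg`): the separator closing `buildS`; the number `h` of Hadamard gates
  modulo `4` (`inc4` over the unary count `hu`); in the odd case the bare-layer separator and
  the un-Hadamard triples on every logical wire `a < n'` (`oddTail`, a counter `ac` in binary) and
  `n' + 2` more increments; the finishing gadget on the dummies when the count is `2 mod 4`
  (`finGadget`) — exactly the case analysis of `thm25SignShapes`;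
* a **header** phase (`headerProg`): the shape count `k` in binary from its unary tally `ku`, and
  the result `⟨bin N, ⟨bin k, body⟩⟩` (or the code of the empty instance when an oracle gate was
  seen, `thm25SignInstance` sending such instances to `KForrelationInstance.empty`).

Every phase comes with its functional model on `St` and a step bound; `runs_prog` chains them
from the initial state for **every** input and `progFn_mem_FP` concludes (`Com.mem_FP`) that the
string function `progFn` computed by the program is in `FP`. Its value on lexed instance codes
is identified with `(thm25SignInstance I).encode` in the sequel.

## References

* S. Aaronson, A. Ambainis, *Forrelation: a problem that optimally separates quantum from
  classical computing*, SIAM J. Comput. 47 (2018) 982–1038; arXiv:1411.5729, §6, Thm. 25.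
* S. Arora, B. Barak, *Computational Complexity: A Modern Approach*, CUP 2009, §1.3, §6.1.
* T. Nipkow, G. Klein, *Concrete Semantics with Isabelle/HOL*, Springer 2014, Ch. 7–8.
-/

namespace Literature.Computability.QuantumComplexity

open _root_.Computability Complexity Complexity.Com Cryptography Thm25Lex

namespace Thm25Asm

/-! ### Two more generic routines -/

section Generic

variable {ι : Type} [DecidableEq ι]

/-- Print every bit of `src` twice on `o`, draining `src`. [folklore] -/
def dblLoop (src o : ι) : Com ι :=
  Com.loop src (Com.push o true ;; Com.push o true) (Com.push o false ;; Com.push o false)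

/-- `dblLoop` prints `rep 2 (src)`. [folklore] -/
theorem runs_dblLoop {src o : ι} (hso : src ≠ o) : ∀ (w : List Bool) (R : Regs ι), R src = w →
    Runs (dblLoop src o) R (Function.update (Function.update R src []) o ((rep 2 w).reverse ++ R o)) (4 * w.length + 1)
  | [], R, h => by
    refine (Runs.loop_nil _ _ h).of_eq ?_ (by simp)
    ext i : 1
    simp only [Function.update_apply, rep_nil, List.reverse_nil, List.nil_append]
    split_ifs <;> simp_all
  | b :: w, R, h => by
    have hbody : ∀ c : Bool, Runs (Com.push o c ;; Com.push o c) (Function.update R src w)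
        (Function.update (Function.update R src w) o (c :: c :: R o)) (1 + 1) := by
      intro c
      refine ((Runs.push o c _).seq (Runs.push o c _)).of_eq ?_ le_rfl
      ext i : 1
      simp only [Function.update_apply]
      split_ifs <;> simp_all
    have hih : ∀ c : Bool, Runs (dblLoop src o) (Function.update (Function.update R src w) o (c :: c :: R o))
        (Function.update (Function.update R src []) o ((rep 2 (c :: w)).reverse ++ R o)) (4 * w.length + 1) := by
      intro c
      refine (runs_dblLoop hso w _ (by simp [hso])).of_eq ?_ le_rfl
      ext i : 1
      simp only [Function.update_apply, rep_cons, List.reverse_append, List.append_assoc]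
      split_ifs <;> simp_all [List.replicate]
    have hcost : 4 * (b :: w).length + 1 = (1 + 1) + 2 + (4 * w.length + 1) := by simp only [List.length_cons]; ring
    rw [hcost]
    cases b
    · exact Runs.loop_false h (hbody false) (hih false)
    · exact Runs.loop_true h (hbody true) (hih true)

/-- Repetition commutes with reversal. [folklore] -/
theorem rep_reverse (m : ℕ) (l : List Bool) : rep m l.reverse = (rep m l).reverse := by
  simp [rep, List.reverse_flatMap, Function.comp_def, List.reverse_replicate]

end Generic

/-! ### The prefix phase -/

/-- Read the unary prefix: every `1` goes to `u`; at the first `0` the rest of the input is moved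
to the stream register `g` (emptying the input, which ends the loop). [folklore] -/
def prefixLoop : Com R := Com.loop .inp (Com.push .u true) (Com.move .inp .g .t)

/-- Model of the prefix loop. [folklore] -/
def prefixM : List Bool → St → St
  | true :: w, s => prefixM w { s with inp := w, u := true :: s.u }
  | false :: w, s => { s with inp := [], g := w ++ s.g }
  | [], s => { s with inp := [] }

/-- The prefix loop runs to its model in at most `9|inp| + 5` steps. [folklore] -/
theorem runs_prefixLoop : ∀ (w : List Bool) (s : St), s.inp = w → s.t = [] →
    Runs prefixLoop s.regs (prefixM w s).regs (9 * w.length + 5)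
  | [], s, hw, _ => by
    refine (Runs.loop_nil _ _ (show s.regs R.inp = [] from hw)).of_eq ?_ (by simp)
    rw [prefixM, ← hw]
  | true :: w, s, hw, ht => by
    have hk : s.regs R.inp = true :: w := hw
    have h1 : Runs (Com.push R.u true) { s with inp := w }.regs { s with inp := w, u := true :: s.u }.regs 1 :=
      Runs.push' (St.upd_u _ _)
    have h2 := runs_prefixLoop w { s with inp := w, u := true :: s.u } rfl ht
    exact (Runs.loop_true' hk (St.upd_inp s w) h1 h2).of_eq (by rw [prefixM]) (by simp; omega)
  | false :: w, s, hw, ht => by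
    have hk : s.regs R.inp = false :: w := hw
    have h1 := runs_move (a := R.inp) (b := R.g) (t := R.t) (by decide) (by decide) (by decide) { s with inp := w }.regs ht
    rw [St.regs_inp, St.regs_g, St.upd_inp, St.upd_g] at h1
    have h2 : Runs prefixLoop { s with inp := ([] : List Bool), g := w ++ s.g }.regs
        { s with inp := ([] : List Bool), g := w ++ s.g }.regs 1 := Runs.loop_nil _ _ rfl
    exact (Runs.loop_false' hk (St.upd_inp s w) h1 h2).of_eq (by rw [prefixM]) (by simp; omega)

/-- On a lexed stream `1ᵐ 0 z` the prefix loop files `1ᵐ` into `u` and `z` into `g`. [folklore] -/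
theorem prefixM_replicate (m : ℕ) (z : List Bool) (s : St) :
    prefixM (List.replicate m true ++ false :: z) s = { s with inp := [], u := List.replicate m true ++ s.u, g := z ++ s.g } := by
  induction m generalizing s with
  | zero => rfl
  | succ m ih =>
    rw [List.replicate_succ, List.cons_append, prefixM, ih]
    simp

/-- The parity loop: pop `u` bit by bit, toggling `p0` and pushing a `1` on `u2`. [folklore] -/
def parityLoop : Com R := Com.loop .u (toggle .p0 ;; Com.push .u2 true) (toggle .p0 ;; Com.push .u2 true)

/-- The parity loop from `p0 = flag b`: `u` emptied, `p0 = flag (b xor |u| odd)`, `|u|` ones on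
`u2`. [folklore] -/
theorem runs_parityLoop : ∀ (w : List Bool) (s : St) (b : Bool), s.u = w → s.p0 = flag b →
    Runs parityLoop s.regs
      { s with u := [], p0 := flag (xor b (decide (w.length % 2 = 1))), u2 := List.replicate w.length true ++ s.u2 }.regs
      (6 * w.length + 1)
  | [], s, b, hw, hp => by
    refine (Runs.loop_nil _ _ (show s.regs R.u = [] from hw)).of_eq ?_ (by simp)
    cases s
    simp only at hw hp
    subst hw hp
    simp
  | a :: w, s, b, hw, hp => by
    have hk : s.regs R.u = a :: w := hw
    have h1 : Runs (toggle R.p0 ;; Com.push R.u2 true) { s with u := w }.regs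
        { s with u := w, p0 := flag (!b), u2 := true :: s.u2 }.regs (3 + 1) := by
      have t1 := runs_toggle R.p0 { s with u := w }.regs b hp
      rw [St.upd_p0] at t1
      exact t1.seq (Runs.push' (St.upd_u2 _ _))
    have h2 := runs_parityLoop w { s with u := w, p0 := flag (!b), u2 := true :: s.u2 } (!b) rfl rfl
    have e : xor (!b) (decide (w.length % 2 = 1)) = xor b (decide ((a :: w).length % 2 = 1)) := by
      simp only [List.length_cons]
      by_cases h : w.length % 2 = 1
      · have h' : ¬ (w.length + 1) % 2 = 1 := by omega
        simp [h, h']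
      · have h' : (w.length + 1) % 2 = 1 := by omega
        simp [h, h']
    rw [e] at h2
    have hfin : ({ s with u := w, p0 := flag (!b), u2 := true :: s.u2 } : St).u2 = true :: s.u2 := rfl
    cases a
    · refine (Runs.loop_false' hk (St.upd_u s w) h1 h2).of_eq ?_ (by simp; omega)
      simp [List.replicate_succ']
    · refine (Runs.loop_true' hk (St.upd_u s w) h1 h2).of_eq ?_ (by simp; omega)
      simp [List.replicate_succ']

/-- The padding step: an odd count clears the parity flag, an even count gets one more `1`
(`n' = n + padCount n`). [cite: AaronsonAmbainis2018, §6 Thm. 25 (proof, the dummy qubit)] -/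
def padStep : Com R := ifFlag .p0 (clearFlag .p0) (Com.push .u2 true)

/-- The padding step from `p0 = flag b`. [folklore] -/
theorem runs_padStep (s : St) (b : Bool) (hp : s.p0 = flag b) :
    Runs padStep s.regs { s with p0 := [], u2 := (bif b then [] else [true]) ++ s.u2 }.regs 6 := by
  cases b
  · have e : Runs (Com.push R.u2 true) s.regs { s with u2 := true :: s.u2 }.regs 1 := Runs.push' (St.upd_u2 s _)
    refine (runs_ifFlag_false _ (show s.regs R.p0 = flag false from hp) e).of_eq ?_ (by omega)
    cases s
    simp only at hp
    subst hp
    simp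
  · have c := runs_clearFlag R.p0 s.regs true hp
    rw [St.upd_p0] at c
    refine (runs_ifFlag_true _ (show s.regs R.p0 = flag true from hp) c).of_eq ?_ (by omega)
    simp

/-- The dummy numerals: `d1 := bin |u2|` (increments driven by a copy of `u2`), `d2 := d1 + 1`,
`nb := d2 + 1`. [cite: AaronsonAmbainis2018, §6 Thm. 25 (proof, p. 27)] -/
def mkDummies : Com R :=
  Com.copy .u2 .uc .t .t2 ;; Com.loop .uc (incR .d1 .t .c) (incR .d1 .t .c) ;;
    Com.copy .d1 .d2 .t .t2 ;; incR .d2 .t .c ;; Com.copy .d2 .nb .t .t2 ;; incR .nb .t .c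

/-- The increment loop driven by `uc`: `d1` counts the popped bits. [folklore] -/
theorem runs_incLoop_d1 : ∀ (w : List Bool) (s : St) (j : ℕ), s.uc = w → s.d1 = encodeNat j → s.t = [] → s.c = [] →
    Runs (Com.loop R.uc (incR .d1 .t .c) (incR .d1 .t .c)) s.regs
      { s with uc := [], d1 := encodeNat (j + w.length) }.regs (w.length * (9 * (j + w.length) + 11) + 1)
  | [], s, j, hw, hd, _, _ => by
    refine (Runs.loop_nil _ _ (show s.regs R.uc = [] from hw)).of_eq ?_ (by simp)
    cases s
    simp only at hw hd
    subst hw hd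
    simp
  | a :: w, s, j, hw, hd, ht, hc => by
    have hk : s.regs R.uc = a :: w := hw
    have h1 := runs_incR (ctr := R.d1) (tmp := R.t) (flg := R.c) (by decide) (by decide) (by decide) j
      { s with uc := w }.regs hd ht hc
    rw [St.upd_d1] at h1
    have h2 := runs_incLoop_d1 w { s with uc := w, d1 := encodeNat (j + 1) } (j + 1) rfl rfl ht hc
    have hl := TokConv.length_encodeNat_le j
    have e : j + 1 + w.length = j + (a :: w).length := by simp; omega
    rw [e] at h2
    have hcost : 9 * (encodeNat j).length + 9 + 2 + (w.length * (9 * (j + (a :: w).length) + 11) + 1) ≤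
        (a :: w).length * (9 * (j + (a :: w).length) + 11) + 1 := by
      simp only [List.length_cons, Nat.succ_mul]
      nlinarith
    cases a
    · exact (Runs.loop_false' hk (St.upd_uc s w) h1 h2).of_eq rfl hcost
    · exact (Runs.loop_true' hk (St.upd_uc s w) h1 h2).of_eq rfl hcost

/-- `mkDummies` computes the three numerals (`m = |u2|`). [folklore] -/
theorem runs_mkDummies (s : St) (huc : s.uc = []) (hd1 : s.d1 = []) (hd2 : s.d2 = []) (hnb : s.nb = [])
    (ht : s.t = []) (ht2 : s.t2 = []) (hc : s.c = []) :
    Runs mkDummies s.regs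
      { s with d1 := encodeNat s.u2.length, d2 := encodeNat (s.u2.length + 1), nb := encodeNat (s.u2.length + 2) }.regs
      (10 * s.u2.length + 3 + (s.u2.length * (9 * s.u2.length + 11) + 1) + (10 * s.u2.length + 3) +
        (9 * (s.u2.length + 1) + 9) + (10 * (s.u2.length + 1) + 3) + (9 * (s.u2.length + 2) + 9)) := by
  set m := s.u2.length with hm
  have e1 := runs_copy (a := R.u2) (b := R.uc) (t := R.t) (u := R.t2) (by decide) (by decide) (by decide) (by decide)
    (by decide) (by decide) s.regs ht ht2
  rw [St.regs_u2, St.regs_uc, St.upd_uc, huc, List.append_nil] at e1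
  set s1 : St := { s with uc := s.u2 } with hs1
  have e2 := runs_incLoop_d1 s.u2 s1 0 rfl (by rw [hd1]; rfl) ht hc
  rw [Nat.zero_add, ← hm] at e2
  set s2 : St := { s1 with uc := [], d1 := encodeNat m } with hs2
  have e3 := runs_copy (a := R.d1) (b := R.d2) (t := R.t) (u := R.t2) (by decide) (by decide) (by decide) (by decide)
    (by decide) (by decide) s2.regs ht ht2
  rw [St.regs_d1, St.regs_d2, St.upd_d2] at e3
  have hs2d2 : s2.d2 = [] := hd2
  have hs2d1 : s2.d1 = encodeNat m := rfl
  rw [hs2d2, hs2d1, List.append_nil] at e3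
  set s3 : St := { s2 with d2 := encodeNat m } with hs3
  have e4 := runs_incR (ctr := R.d2) (tmp := R.t) (flg := R.c) (by decide) (by decide) (by decide) m s3.regs rfl ht hc
  rw [St.upd_d2] at e4
  set s4 : St := { s3 with d2 := encodeNat (m + 1) } with hs4
  have e5 := runs_copy (a := R.d2) (b := R.nb) (t := R.t) (u := R.t2) (by decide) (by decide) (by decide) (by decide)
    (by decide) (by decide) s4.regs ht ht2
  rw [St.regs_d2, St.regs_nb, St.upd_nb] at e5
  have hs4nb : s4.nb = [] := hnb
  have hs4d2 : s4.d2 = encodeNat (m + 1) := rfl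
  rw [hs4nb, hs4d2, List.append_nil] at e5
  set s5 : St := { s4 with nb := encodeNat (m + 1) } with hs5
  have e6 := runs_incR (ctr := R.nb) (tmp := R.t) (flg := R.c) (by decide) (by decide) (by decide) (m + 1) s5.regs rfl ht hc
  rw [St.upd_nb] at e6
  have hl0 := TokConv.length_encodeNat_le m
  have hl1 := TokConv.length_encodeNat_le (m + 1)
  refine (e1.seq (e2.seq (e3.seq (e4.seq (e5.seq e6))))).of_eq ?_ (by omega)
  simp only [hs5, hs4, hs3, hs2, hs1, huc]

/-! ### The tail phase -/

/-- The blocks of the un-Hadamard triples on the wires `j, j + 1, …, j + m - 1`.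
[cite: AaronsonAmbainis2018, §6 Thm. 25 (proof)] -/
def oddBlocks (d₁ d₂ : List Bool) : ℕ → ℕ → List Bool
  | _, 0 => []
  | j, m + 1 => blockH (encodeNat j) d₁ d₂ ++ oddBlocks d₁ d₂ (j + 1) m

/-- Length of a Hadamard block. [folklore] -/
theorem length_blockH (u d₁ d₂ : List Bool) :
    (blockH u d₁ d₂).length = 96 * u.length + 96 * d₁.length + 96 * d₂.length + 1584 := by
  simp only [blockH, List.length_append, length_codeTwoL, length_codeNoneL]; omega

/-- Length of the odd-tail blocks. [folklore] -/
theorem length_oddBlocks_le (d₁ d₂ : List Bool) : ∀ (j m : ℕ),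
    (oddBlocks d₁ d₂ j m).length ≤ m * (96 * (j + m) + 96 * d₁.length + 96 * d₂.length + 1584)
  | j, 0 => by simp [oddBlocks]
  | j, m + 1 => by
    rw [oddBlocks, List.length_append, length_blockH]
    have ih := length_oddBlocks_le d₁ d₂ (j + 1) m
    have hl := TokConv.length_encodeNat_le j
    nlinarith

/-- One step of the odd tail: the triple on the wire counted by `ac`, twelve tallies, increment.
[cite: AaronsonAmbainis2018, §6 Thm. 25 (proof)] -/
def tripStep : Com R := triple .ac ;; pushList .ku (List.replicate 12 true) ;; incR .ac .t .c

/-- `tripStep` runs. [folklore] -/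
theorem runs_tripStep (s : St) (j : ℕ) (hac : s.ac = encodeNat j) (ht : s.t = []) (hc : s.c = []) :
    Runs tripStep s.regs
      { s with
        o := (blockH (encodeNat j) s.d1 s.d2).reverse ++ s.o
        ku := List.replicate 12 true ++ s.ku
        ac := encodeNat (j + 1) }.regs
      (132 * (encodeNat j).length + 132 * s.d1.length + 132 * s.d2.length + 1620 + 12 + (9 * (encodeNat j).length + 9)) := by
  have e1 := runs_triple (a := R.ac) (by decide) (by decide) s (show s.regs R.ac = encodeNat j from hac) ht
  set s1 : St := { s with o := (blockH (encodeNat j) s.d1 s.d2).reverse ++ s.o } with hs1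
  have e2 := runs_pushList R.ku (List.replicate 12 true) s1.regs
  rw [St.upd_ku, St.regs_ku, List.reverse_replicate, List.length_replicate] at e2
  set s2 : St := { s1 with ku := List.replicate 12 true ++ s1.ku } with hs2
  have e3 := runs_incR (ctr := R.ac) (tmp := R.t) (flg := R.c) (by decide) (by decide) (by decide) j s2.regs hac ht hc
  rw [St.upd_ac] at e3
  exact (e1.seq (e2.seq e3)).of_eq rfl (by omega)

/-- The loop of triples driven by `uc`. [cite: AaronsonAmbainis2018, §6 Thm. 25 (proof)] -/
theorem runs_tripLoop : ∀ (w : List Bool) (s : St) (j : ℕ), s.uc = w → s.ac = encodeNat j → s.t = [] → s.c = [] →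
    Runs (Com.loop R.uc tripStep tripStep) s.regs
      { s with
        uc := []
        o := (oddBlocks s.d1 s.d2 j w.length).reverse ++ s.o
        ku := List.replicate (12 * w.length) true ++ s.ku
        ac := encodeNat (j + w.length) }.regs
      (w.length * (141 * (j + w.length) + 132 * s.d1.length + 132 * s.d2.length + 1643) + 1)
  | [], s, j, hw, hac, _, _ => by
    refine (Runs.loop_nil _ _ (show s.regs R.uc = [] from hw)).of_eq ?_ (by simp)
    cases s
    simp only at hw hac
    subst hw hac
    simp [oddBlocks]
  | a :: w, s, j, hw, hac, ht, hc => by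
    have hk : s.regs R.uc = a :: w := hw
    have h1 := runs_tripStep { s with uc := w } j hac ht hc
    set s1 : St :=
      { s with
        uc := w
        o := (blockH (encodeNat j) s.d1 s.d2).reverse ++ s.o
        ku := List.replicate 12 true ++ s.ku
        ac := encodeNat (j + 1) } with hs1
    have h2 := runs_tripLoop w s1 (j + 1) rfl rfl ht hc
    have hl := TokConv.length_encodeNat_le j
    have e : j + 1 + w.length = j + (a :: w).length := by simp; omega
    rw [e] at h2
    have hfin :
        ({ s1 with
            uc := []
            o := (oddBlocks s1.d1 s1.d2 (j + 1) w.length).reverse ++ s1.o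
            ku := List.replicate (12 * w.length) true ++ s1.ku
            ac := encodeNat (j + (a :: w).length) } : St).regs =
        ({ s with
            uc := []
            o := (oddBlocks s.d1 s.d2 j (a :: w).length).reverse ++ s.o
            ku := List.replicate (12 * (a :: w).length) true ++ s.ku
            ac := encodeNat (j + (a :: w).length) } : St).regs := by
      simp only [hs1, List.length_cons, oddBlocks, List.reverse_append, List.append_assoc, Nat.mul_succ,
        replicate_append_replicate_append]
    rw [hfin] at h2
    have hcost : 132 * (encodeNat j).length + 132 * s.d1.length + 132 * s.d2.length + 1620 + 12 +
        (9 * (encodeNat j).length + 9) + 2 +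
        (w.length * (141 * (j + (a :: w).length) + 132 * s1.d1.length + 132 * s1.d2.length + 1643) + 1) ≤
        (a :: w).length * (141 * (j + (a :: w).length) + 132 * s.d1.length + 132 * s.d2.length + 1643) + 1 := by
      have hd1 : s1.d1 = s.d1 := rfl
      have hd2 : s1.d2 = s.d2 := rfl
      rw [hd1, hd2]
      simp only [List.length_cons, Nat.succ_mul]
      nlinarith
    cases a
    · exact (Runs.loop_false' hk (St.upd_uc s w) h1 h2).of_eq rfl hcost
    · exact (Runs.loop_true' hk (St.upd_uc s w) h1 h2).of_eq rfl hcost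

section Inc4Loop

variable {ι : Type} [DecidableEq ι]

/-- The counter modulo `4` driven by the bits of a register `r`. [folklore] -/
theorem runs_inc4Loop {r p0 p1 : ι} (h0 : r ≠ p0) (h1 : r ≠ p1) (hp : p0 ≠ p1) :
    ∀ (w : List Bool) (R : Regs ι) (q : Bool × Bool), R r = w → R p0 = flag q.1 → R p1 = flag q.2 →
      Runs (Com.loop r (inc4 p0 p1) (inc4 p0 p1)) R
        (Function.update (Function.update (Function.update R r []) p0 (flag (inc4F^[w.length] q).1)) p1
          (flag (inc4F^[w.length] q).2)) (13 * w.length + 1)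
  | [], R, q, hw, hq0, hq1 => by
    refine (Runs.loop_nil _ _ hw).of_eq ?_ (by simp)
    ext i : 1
    simp only [Function.update_apply, List.length_nil, Function.iterate_zero, id_eq]
    split_ifs <;> simp_all
  | a :: w, R, q, hw, hq0, hq1 => by
    have hb := runs_inc4 hp (Function.update R r w) q.1 q.2 (by simp [h0.symm, hq0]) (by simp [h1.symm, hq1])
    set R₁ := Function.update (Function.update (Function.update R r w) p0 (flag (inc4F (q.1, q.2)).1)) p1
      (flag (inc4F (q.1, q.2)).2) with hR₁
    have ih := runs_inc4Loop h0 h1 hp w R₁ (inc4F q) (by simp [hR₁, h0, h1]) (by simp [hR₁, hp]) (by simp [hR₁])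
    have e : Function.update (Function.update (Function.update R₁ r []) p0 (flag (inc4F^[w.length] (inc4F q)).1)) p1
        (flag (inc4F^[w.length] (inc4F q)).2) =
        Function.update (Function.update (Function.update R r []) p0 (flag (inc4F^[(a :: w).length] q).1)) p1
          (flag (inc4F^[(a :: w).length] q).2) := by
      ext i : 1
      simp only [hR₁, Function.update_apply, List.length_cons, Function.iterate_succ_apply]
      split_ifs <;> simp_all
    rw [e] at ih
    have hcost : 13 * (a :: w).length + 1 = 11 + 2 + (13 * w.length + 1) := by simp only [List.length_cons]; ring
    rw [hcost]
    cases a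
    · exact Runs.loop_false hw hb ih
    · exact Runs.loop_true hw hb ih

end Inc4Loop

/-- The finishing gadget on the dummies, preceded by its separator. [cite: AaronsonAmbainis2018, §6 Thm. 25 (proof)] -/
def finGadget : Com R := emitNone ;; gadget .d1 .d2 ;; pushList .ku (List.replicate 4 true)

/-- The printed finishing part. [cite: AaronsonAmbainis2018, §6 Thm. 25 (proof)] -/
def finBits (d₁ d₂ : List Bool) : List Bool := codeNoneL ++ (codeTwoL d₁ d₂ ++ codeTwoL d₁ d₂ ++ codeTwoL d₁ d₂)

/-- `finGadget` runs. [folklore] -/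
theorem runs_finGadget (s : St) (ht : s.t = []) :
    Runs finGadget s.regs { s with o := (finBits s.d1 s.d2).reverse ++ s.o, ku := List.replicate 4 true ++ s.ku }.regs
      (48 + 3 * (22 * s.d1.length + 22 * s.d2.length + 164) + 4) := by
  have e1 := runs_emitNone s
  set s1 : St := { s with o := codeNoneL.reverse ++ s.o } with hs1
  have e2 := runs_gadget (s1 := R.d1) (s2 := R.d2) (by decide) (by decide) (by decide) (by decide) s1
    (show s1.regs R.d1 = s.d1 from rfl) (show s1.regs R.d2 = s.d2 from rfl) ht
  set s2 : St := { s1 with o := (codeTwoL s.d1 s.d2 ++ codeTwoL s.d1 s.d2 ++ codeTwoL s.d1 s.d2).reverse ++ s1.o } with hs2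
  have e3 := runs_pushList R.ku (List.replicate 4 true) s2.regs
  rw [St.upd_ku, St.regs_ku, List.reverse_replicate, List.length_replicate] at e3
  refine (e1.seq (e2.seq e3)).of_eq ?_ (by omega)
  simp only [hs2, hs1, finBits, List.reverse_append, List.append_assoc]

/-- **The odd tail**: the un-Hadamard triples on all logical wires `a < n'` (`n' = |u2|`; the
bare-layer separator in front of them is the separator already printed after the gate blocks),
the closing separator, and `n' + 2` more increments of the counter modulo `4`.
[cite: AaronsonAmbainis2018, §6 Thm. 25 (proof, p. 27)] -/
def oddTail : Com R :=
  Com.copy .u2 .uc .t .t2 ;; Com.loop R.uc tripStep tripStep ;;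
    emitNone ;; Com.push .ku true ;; Com.copy .u2 .uc .t .t2 ;; Com.loop R.uc (inc4 .p0 .p1) (inc4 .p0 .p1) ;;
    inc4 .p0 .p1 ;; inc4 .p0 .p1

/-- The printed odd tail for `m` logical wires: the triples and the separator closing `buildS`
(the separator in front of them is the one closing the gate blocks). [cite: AaronsonAmbainis2018, §6 Thm. 25 (proof)] -/
def oddBits (m : ℕ) (d₁ d₂ : List Bool) : List Bool := oddBlocks d₁ d₂ 0 m ++ codeNoneL

/-- `oddTail` runs (from the parity flag set and the second bit `b`). [folklore] -/
theorem runs_oddTail (s : St) (b : Bool) (hp0 : s.p0 = flag true) (hp1 : s.p1 = flag b) (huc : s.uc = [])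
    (hac : s.ac = []) (ht : s.t = []) (ht2 : s.t2 = []) (hc : s.c = []) :
    Runs oddTail s.regs
      { s with
        o := (oddBits s.u2.length s.d1 s.d2).reverse ++ s.o
        ku := List.replicate (12 * s.u2.length + 1) true ++ s.ku
        ac := encodeNat s.u2.length
        p0 := flag (inc4F^[s.u2.length + 2] (true, b)).1
        p1 := flag (inc4F^[s.u2.length + 2] (true, b)).2 }.regs
      ((10 * s.u2.length + 3) +
        (s.u2.length * (141 * s.u2.length + 132 * s.d1.length + 132 * s.d2.length + 1643) + 1) +
        48 + 1 + (10 * s.u2.length + 3) + (13 * s.u2.length + 1) + 11 + 11) := by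
  set m := s.u2.length with hm
  have e3 := runs_copy (a := R.u2) (b := R.uc) (t := R.t) (u := R.t2) (by decide) (by decide) (by decide) (by decide)
    (by decide) (by decide) s.regs ht ht2
  rw [St.regs_u2, St.regs_uc, St.upd_uc, huc, List.append_nil] at e3
  set s3 : St := { s with uc := s.u2 } with hs3
  have e4 := runs_tripLoop s.u2 s3 0 rfl (show s3.ac = encodeNat 0 by rw [TokConv.encodeNat_zero']; exact hac) ht hc
  rw [Nat.zero_add, ← hm] at e4
  set s4 : St :=
    { s3 with
      uc := []
      o := (oddBlocks s3.d1 s3.d2 0 m).reverse ++ s3.o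
      ku := List.replicate (12 * m) true ++ s3.ku
      ac := encodeNat m } with hs4
  have e5 := runs_emitNone s4
  set s5 : St := { s4 with o := codeNoneL.reverse ++ s4.o } with hs5
  have e6 : Runs (Com.push R.ku true) s5.regs { s5 with ku := true :: s5.ku }.regs 1 := Runs.push' (St.upd_ku _ _)
  set s6 : St := { s5 with ku := true :: s5.ku } with hs6
  have e7 := runs_copy (a := R.u2) (b := R.uc) (t := R.t) (u := R.t2) (by decide) (by decide) (by decide) (by decide)
    (by decide) (by decide) s6.regs ht ht2
  rw [St.regs_u2, St.regs_uc, St.upd_uc] at e7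
  have hs6uc : s6.uc = [] := rfl
  have hs6u2 : s6.u2 = s.u2 := rfl
  rw [hs6uc, hs6u2, List.append_nil] at e7
  set s7 : St := { s6 with uc := s.u2 } with hs7
  have e8 := runs_inc4Loop (r := R.uc) (p0 := R.p0) (p1 := R.p1) (by decide) (by decide) (by decide) s.u2 s7.regs (true, b)
    rfl hp0 hp1
  rw [St.upd_uc, St.upd_p0, St.upd_p1, ← hm] at e8
  set s8 : St := { s7 with uc := [], p0 := flag (inc4F^[m] (true, b)).1, p1 := flag (inc4F^[m] (true, b)).2 } with hs8
  have e9 := runs_inc4 (p0 := R.p0) (p1 := R.p1) (by decide) s8.regs (inc4F^[m] (true, b)).1 (inc4F^[m] (true, b)).2 rfl rfl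
  rw [St.upd_p0, St.upd_p1, Prod.mk.eta, ← Function.iterate_succ_apply' inc4F m] at e9
  set s9 : St := { s8 with p0 := flag (inc4F^[m + 1] (true, b)).1, p1 := flag (inc4F^[m + 1] (true, b)).2 } with hs9
  have e10 := runs_inc4 (p0 := R.p0) (p1 := R.p1) (by decide) s9.regs (inc4F^[m + 1] (true, b)).1
    (inc4F^[m + 1] (true, b)).2 rfl rfl
  rw [St.upd_p0, St.upd_p1, Prod.mk.eta, ← Function.iterate_succ_apply' inc4F (m + 1)] at e10
  refine (e3.seq (e4.seq (e5.seq (e6.seq (e7.seq (e8.seq (e9.seq e10))))))).of_eq ?_ ?_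
  · simp only [hs9, hs8, hs7, hs6, hs5, hs4, hs3, oddBits, huc, List.reverse_append, List.append_assoc]
    simp [List.replicate_succ]
  · simp only [hs3]
    omega

/-- **The tail**: the separator closing `buildS`, `h mod 4` from the unary Hadamard count, the
odd tail when `h` is odd, and the finishing gadget when the final count is `2 mod 4`.
[cite: AaronsonAmbainis2018, §6 Thm. 25 (proof, p. 27)] -/
def tailProg : Com R :=
  emitNone ;; Com.push .ku true ;; Com.loop R.hu (inc4 .p0 .p1) (inc4 .p0 .p1) ;;
    ifFlag .p0 oddTail Com.skip ;; ifFlag .p1 (ifFlag .p0 Com.skip finGadget) Com.skip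

/-- The counter modulo `4` at the end of the tail: `h mod 4`, advanced by `n' + 2` when `h` is
odd. [cite: AaronsonAmbainis2018, §6 Thm. 25 (proof)] -/
def qAfter (h m : ℕ) : Bool × Bool :=
  if (inc4F^[h] (false, false)).1 then inc4F^[m + 2] (inc4F^[h] (false, false)) else inc4F^[h] (false, false)

/-- Whether the finishing gadget is printed: the final count is `2 mod 4`. [folklore] -/
def finOf (q : Bool × Bool) : Bool := q.2 && !q.1

/-- The printed tail for Hadamard parity `hpar`, finishing decision `fin`, `m` logical wires.
[cite: AaronsonAmbainis2018, §6 Thm. 25 (proof)] -/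
def tailBits (hpar fin : Bool) (m : ℕ) (d₁ d₂ : List Bool) : List Bool :=
  codeNoneL ++ (bif hpar then oddBits m d₁ d₂ else []) ++ (bif fin then finBits d₁ d₂ else [])

/-- The number of shapes printed by the tail. [folklore] -/
def tailKu (hpar fin : Bool) (m : ℕ) : ℕ := (bif fin then 4 else 0) + (bif hpar then 12 * m + 1 else 0) + 1

/-- Model of the tail. [folklore] -/
def tailM (s : St) : St :=
  { s with
    o := (tailBits (inc4F^[s.hu.length] (false, false)).1 (finOf (qAfter s.hu.length s.u2.length)) s.u2.length
          s.d1 s.d2).reverse ++ s.o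
    ku := List.replicate (tailKu (inc4F^[s.hu.length] (false, false)).1
          (finOf (qAfter s.hu.length s.u2.length)) s.u2.length) true ++ s.ku
    hu := []
    ac := (bif (inc4F^[s.hu.length] (false, false)).1 then encodeNat s.u2.length else s.ac)
    p0 := flag (qAfter s.hu.length s.u2.length).1
    p1 := flag (qAfter s.hu.length s.u2.length).2 }

/-- A (generous) step bound for the tail, in the number `m` of logical wires, the Hadamard count
`h` and the dummy lengths. [folklore] -/
def tailCost (m h e₁ e₂ : ℕ) : ℕ :=
  240 + 13 * h + 40 * m + m * (141 * m + 132 * e₁ + 132 * e₂ + 1643) + 3 * (22 * e₁ + 22 * e₂ + 164)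

/-- **The tail runs to its model.** [folklore] -/
theorem runs_tailProg (s : St) (hp0 : s.p0 = []) (hp1 : s.p1 = []) (huc : s.uc = []) (hac : s.ac = [])
    (ht : s.t = []) (ht2 : s.t2 = []) (hc : s.c = []) :
    Runs tailProg s.regs (tailM s).regs (tailCost s.u2.length s.hu.length s.d1.length s.d2.length) := by
  set m := s.u2.length with hm
  set h := s.hu.length with hh
  have e1 := runs_emitNone s
  set s1 : St := { s with o := codeNoneL.reverse ++ s.o } with hs1
  have e2 : Runs (Com.push R.ku true) s1.regs { s1 with ku := true :: s1.ku }.regs 1 := Runs.push' (St.upd_ku _ _)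
  set s2 : St := { s1 with ku := true :: s1.ku } with hs2
  have e3 := runs_inc4Loop (r := R.hu) (p0 := R.p0) (p1 := R.p1) (by decide) (by decide) (by decide) s.hu s2.regs
    (false, false) rfl hp0 hp1
  rw [St.upd_hu, St.upd_p0, St.upd_p1, ← hh] at e3
  set q₁ := inc4F^[h] (false, false) with hq₁
  set s3 : St := { s2 with hu := [], p0 := flag q₁.1, p1 := flag q₁.2 } with hs3
  -- the odd tail or nothing
  set q := qAfter h m with hq
  set s4 : St :=
    { s3 with
      o := (bif q₁.1 then oddBits m s.d1 s.d2 else []).reverse ++ s3.o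
      ku := List.replicate (bif q₁.1 then 12 * m + 1 else 0) true ++ s3.ku
      ac := (bif q₁.1 then encodeNat m else s.ac)
      p0 := flag q.1
      p1 := flag q.2 } with hs4
  have e4 : Runs (ifFlag R.p0 oddTail Com.skip) s3.regs s4.regs
      ((10 * m + 3) + (m * (141 * m + 132 * s.d1.length + 132 * s.d2.length + 1643) + 1) +
        48 + 1 + (10 * m + 3) + (13 * m + 1) + 11 + 11 + 3) := by
    cases hpar : q₁.1
    · have hq' : q = q₁ := by rw [hq, qAfter, ← hq₁, hpar]; rfl
      refine (runs_ifFlag_false _ (show s3.regs R.p0 = flag false by simp [hs3, hpar]) (Runs.skip _)).of_eq ?_ (by omega)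
      simp only [hs4, hs3, hs2, hs1, hq', hpar, cond_false, List.reverse_nil, List.nil_append, List.replicate_zero]
    · have hq' : q = inc4F^[m + 2] (true, q₁.2) := by
        rw [hq, qAfter, ← hq₁, hpar]; simp only [↓reduceIte]; rw [← hpar, Prod.mk.eta]
      have ho := runs_oddTail s3 q₁.2 (by simp [hs3, hpar]) rfl huc hac ht ht2 hc
      refine (runs_ifFlag_true _ (show s3.regs R.p0 = flag true by simp [hs3, hpar]) ho).of_eq ?_
        (by simp only [hs3, hs2, hs1, ← hm]; omega)
      simp only [hs4, hq', hs3, hs2, hs1, hpar, cond_true, ← hm]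
  -- the finishing gadget or nothing
  set s5 : St :=
    { s4 with
      o := (bif finOf q then finBits s.d1 s.d2 else []).reverse ++ s4.o
      ku := List.replicate (bif finOf q then 4 else 0) true ++ s4.ku } with hs5
  have e5 : Runs (ifFlag R.p1 (ifFlag R.p0 Com.skip finGadget) Com.skip) s4.regs s5.regs
      (48 + 3 * (22 * s.d1.length + 22 * s.d2.length + 164) + 4 + 3 + 3) := by
    have h40 : s4.regs R.p0 = flag q.1 := rfl
    have h41 : s4.regs R.p1 = flag q.2 := rfl
    cases hq2 : q.2
    · refine (runs_ifFlag_false _ (by rw [h41, hq2]) (Runs.skip _)).of_eq ?_ (by omega)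
      simp only [hs5, finOf, hq2, Bool.false_and, cond_false, List.reverse_nil, List.nil_append, List.replicate_zero]
    · cases hq1 : q.1
      · have hf := runs_finGadget s4 ht
        refine (runs_ifFlag_true _ (by rw [h41, hq2]) (runs_ifFlag_false _ (by rw [h40, hq1]) hf)).of_eq ?_
          (by simp only [hs4, hs3, hs2, hs1]; omega)
        simp only [hs5, finOf, hq2, hq1, Bool.not_false, Bool.and_self, cond_true]
        rfl
      · refine (runs_ifFlag_true _ (by rw [h41, hq2]) (runs_ifFlag_true _ (by rw [h40, hq1]) (Runs.skip _))).of_eq ?_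
          (by omega)
        simp only [hs5, finOf, hq2, hq1, Bool.not_true, Bool.and_false, cond_false, List.reverse_nil, List.nil_append,
          List.replicate_zero]
  refine (e1.seq (e2.seq (e3.seq (e4.seq e5)))).of_eq ?_ ?_
  · simp only [hs5, hs4, hs3, hs2, hs1, tailM, ← hh, ← hm, ← hq₁, tailBits, tailKu, List.reverse_append,
      List.append_assoc, List.replicate_add]
    rfl
  · simp only [tailCost]
    omega

/-! ### The header phase -/

/-- The shape count in binary: increments driven by the unary tally `ku`. [folklore] -/
def kLoop : Com R := Com.loop .ku (incR .k .t .c) (incR .k .t .c)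

/-- The tally loop: `k` counts the popped bits. [folklore] -/
theorem runs_kLoop : ∀ (w : List Bool) (s : St) (j : ℕ), s.ku = w → s.k = encodeNat j → s.t = [] → s.c = [] →
    Runs kLoop s.regs { s with ku := [], k := encodeNat (j + w.length) }.regs (w.length * (9 * (j + w.length) + 11) + 1)
  | [], s, j, hw, hd, _, _ => by
    refine (Runs.loop_nil _ _ (show s.regs R.ku = [] from hw)).of_eq ?_ (by simp)
    cases s
    simp only at hw hd
    subst hw hd
    simp
  | a :: w, s, j, hw, hd, ht, hc => by
    have hk : s.regs R.ku = a :: w := hw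
    have h1 := runs_incR (ctr := R.k) (tmp := R.t) (flg := R.c) (by decide) (by decide) (by decide) j
      { s with ku := w }.regs hd ht hc
    rw [St.upd_k] at h1
    have h2 := runs_kLoop w { s with ku := w, k := encodeNat (j + 1) } (j + 1) rfl rfl ht hc
    have hl := TokConv.length_encodeNat_le j
    have e : j + 1 + w.length = j + (a :: w).length := by simp; omega
    rw [e] at h2
    have hcost : 9 * (encodeNat j).length + 9 + 2 + (w.length * (9 * (j + (a :: w).length) + 11) + 1) ≤
        (a :: w).length * (9 * (j + (a :: w).length) + 11) + 1 := by
      simp only [List.length_cons, Nat.succ_mul]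
      nlinarith
    cases a
    · exact (Runs.loop_false' hk (St.upd_ku s w) h1 h2).of_eq rfl hcost
    · exact (Runs.loop_true' hk (St.upd_ku s w) h1 h2).of_eq rfl hcost

/-- **The header**: `k` in binary, then the result `⟨bin N, ⟨bin k, body⟩⟩` — or the code `0101` of
the empty instance if an oracle gate was seen. [cite: AaronsonAmbainis2018, §6 Thm. 25 (proof)] -/
def headerProg : Com R :=
  kLoop ;; ifFlag .fo (pushList .res [true, false, true, false])
    (Com.pour .o .res ;; Com.push .res true ;; Com.push .res false ;; Com.pour .k .t ;; dblLoop .t .res ;;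
      Com.push .res true ;; Com.push .res false ;; Com.pour .nb .t ;; dblLoop .t .res)

/-- Model of the header (from `k = []`). [folklore] -/
def headerM (s : St) : St :=
  if s.fo = [] then
    { s with
      ku := [], k := [], nb := [], o := [], t := []
      res := rep 2 s.nb ++ (false :: true :: (rep 2 (encodeNat s.ku.length) ++ (false :: true :: (s.o.reverse ++ s.res)))) }
  else { s with ku := [], k := encodeNat s.ku.length, res := false :: true :: false :: true :: s.res }

/-- A step bound for the header. [folklore] -/
def headerCost (ku o nb : ℕ) : ℕ := ku * (9 * ku + 11) + 7 * ku + 3 * o + 7 * nb + 20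

/-- **The header runs to its model.** [folklore] -/
theorem runs_headerProg (s : St) (hk : s.k = []) (ht : s.t = []) (hc : s.c = []) (hfo : IsFlag s.fo) :
    Runs headerProg s.regs (headerM s).regs (headerCost s.ku.length s.o.length s.nb.length) := by
  obtain ⟨bo, hbo⟩ := hfo
  have e1 := runs_kLoop s.ku s 0 rfl (by rw [hk]; rfl) ht hc
  rw [Nat.zero_add] at e1
  set K := s.ku.length with hK
  set s1 : St := { s with ku := [], k := encodeNat K } with hs1
  have hl := TokConv.length_encodeNat_le K
  have hfo1 : s1.regs R.fo = flag bo := hbo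
  unfold headerProg headerM
  cases bo
  · have hfo0 : s.fo = [] := hbo
    rw [if_pos hfo0]
    have e2 := runs_pour (a := R.o) (b := R.res) (by decide) s1.regs
    rw [St.regs_o, St.regs_res, St.upd_o, St.upd_res] at e2
    set s2 : St := { s1 with o := [], res := s1.o.reverse ++ s1.res } with hs2
    have e3a : Runs (Com.push R.res true) s2.regs { s2 with res := true :: s2.res }.regs 1 := Runs.push' (St.upd_res s2 _)
    set s3a : St := { s2 with res := true :: s2.res } with hs3a
    have e3b : Runs (Com.push R.res false) s3a.regs { s3a with res := false :: s3a.res }.regs 1 := Runs.push' (St.upd_res s3a _)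
    set s3 : St := { s3a with res := false :: s3a.res } with hs3
    have e4 := runs_pour (a := R.k) (b := R.t) (by decide) s3.regs
    rw [St.regs_k, St.regs_t, St.upd_k, St.upd_t] at e4
    have hs3t : s3.t = [] := ht
    have hs3k : s3.k = encodeNat K := rfl
    rw [hs3t, hs3k, List.append_nil] at e4
    set s4 : St := { s3 with k := [], t := (encodeNat K).reverse } with hs4
    have e5 := runs_dblLoop (src := R.t) (o := R.res) (by decide) (encodeNat K).reverse s4.regs rfl
    rw [St.upd_t, St.regs_res, St.upd_res, rep_reverse, List.reverse_reverse] at e5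
    set s5 : St := { s4 with t := [], res := rep 2 (encodeNat K) ++ s4.res } with hs5
    have e6a : Runs (Com.push R.res true) s5.regs { s5 with res := true :: s5.res }.regs 1 := Runs.push' (St.upd_res s5 _)
    set s6a : St := { s5 with res := true :: s5.res } with hs6a
    have e6b : Runs (Com.push R.res false) s6a.regs { s6a with res := false :: s6a.res }.regs 1 := Runs.push' (St.upd_res s6a _)
    set s6 : St := { s6a with res := false :: s6a.res } with hs6
    have e7 := runs_pour (a := R.nb) (b := R.t) (by decide) s6.regs
    rw [St.regs_nb, St.regs_t, St.upd_nb, St.upd_t] at e7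
    have hs6t : s6.t = [] := rfl
    have hs6nb : s6.nb = s.nb := rfl
    rw [hs6t, hs6nb, List.append_nil] at e7
    set s7 : St := { s6 with nb := [], t := s.nb.reverse } with hs7
    have e8 := runs_dblLoop (src := R.t) (o := R.res) (by decide) s.nb.reverse s7.regs rfl
    rw [St.upd_t, St.regs_res, St.upd_res, rep_reverse, List.reverse_reverse] at e8
    refine (e1.seq (runs_ifFlag_false _ hfo1
      (e2.seq (e3a.seq (e3b.seq (e4.seq (e5.seq (e6a.seq (e6b.seq (e7.seq e8)))))))))).of_eq ?_ ?_
    · simp only [hs7, hs6, hs6a, hs5, hs4, hs3, hs3a, hs2, hs1, ← hK]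
    · simp only [hs1, List.length_reverse, headerCost]
      nlinarith [hl]
  · have hfo1' : s.fo ≠ [] := by rw [hbo]; simp
    rw [if_neg hfo1']
    have e2 := runs_pushList R.res [true, false, true, false] s1.regs
    rw [St.upd_res, St.regs_res] at e2
    refine (e1.seq (runs_ifFlag_true _ hfo1 e2)).of_eq ?_ ?_
    · simp [hs1, ← hK]
    · simp only [List.length_cons, List.length_nil, headerCost]
      nlinarith

/-! ### Frame and size facts of the gate loop -/

/-- `commit` does not touch `inp`. [folklore] -/
@[simp] theorem commitM_inp (s : St) : (commitM s).inp = s.inp := by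
  unfold commitM; split_ifs <;> rfl
/-- `commit` does not touch `u`. [folklore] -/
@[simp] theorem commitM_u (s : St) : (commitM s).u = s.u := by
  unfold commitM; split_ifs <;> rfl
/-- `commit` does not touch `u2`. [folklore] -/
@[simp] theorem commitM_u2 (s : St) : (commitM s).u2 = s.u2 := by
  unfold commitM; split_ifs <;> rfl
/-- `commit` does not touch `uc`. [folklore] -/
@[simp] theorem commitM_uc (s : St) : (commitM s).uc = s.uc := by
  unfold commitM; split_ifs <;> rfl
/-- `commit` does not touch `d1`. [folklore] -/
@[simp] theorem commitM_d1 (s : St) : (commitM s).d1 = s.d1 := by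
  unfold commitM; split_ifs <;> rfl
/-- `commit` does not touch `d2`. [folklore] -/
@[simp] theorem commitM_d2 (s : St) : (commitM s).d2 = s.d2 := by
  unfold commitM; split_ifs <;> rfl
/-- `commit` does not touch `nb`. [folklore] -/
@[simp] theorem commitM_nb (s : St) : (commitM s).nb = s.nb := by
  unfold commitM; split_ifs <;> rfl
/-- `commit` does not touch `k`. [folklore] -/
@[simp] theorem commitM_k (s : St) : (commitM s).k = s.k := by
  unfold commitM; split_ifs <;> rfl
/-- `commit` does not touch `ac`. [folklore] -/
@[simp] theorem commitM_ac (s : St) : (commitM s).ac = s.ac := by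
  unfold commitM; split_ifs <;> rfl
/-- `commit` does not touch `p0`. [folklore] -/
@[simp] theorem commitM_p0 (s : St) : (commitM s).p0 = s.p0 := by
  unfold commitM; split_ifs <;> rfl
/-- `commit` does not touch `p1`. [folklore] -/
@[simp] theorem commitM_p1 (s : St) : (commitM s).p1 = s.p1 := by
  unfold commitM; split_ifs <;> rfl
/-- `commit` does not touch `t`. [folklore] -/
@[simp] theorem commitM_t (s : St) : (commitM s).t = s.t := by
  unfold commitM; split_ifs <;> rfl
/-- `commit` does not touch `t2`. [folklore] -/
@[simp] theorem commitM_t2 (s : St) : (commitM s).t2 = s.t2 := by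
  unfold commitM; split_ifs <;> rfl
/-- `commit` does not touch `c`. [folklore] -/
@[simp] theorem commitM_c (s : St) : (commitM s).c = s.c := by
  unfold commitM; split_ifs <;> rfl
/-- `commit` does not touch `res`. [folklore] -/
@[simp] theorem commitM_res (s : St) : (commitM s).res = s.res := by
  unfold commitM; split_ifs <;> rfl

/-- The handlers do not touch `inp`. [folklore] -/
@[simp] theorem actM_inp (a b d : Bool) (s : St) : (actM a b d s).inp = s.inp := by
  cases a <;> cases b <;> cases d <;> simp only [actM, hKHM, hKZM, hKCZM, hKCCZM, hKORM, cleanupM, commitM_inp]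
/-- The gate loop does not touch `inp`. [folklore] -/
@[simp] theorem loopM_inp : ∀ (z : List Bool) (s : St), (loopM z s).inp = s.inp
  | [], _ => rfl
  | [_], _ => rfl
  | [_, _], _ => rfl
  | a :: b :: d :: z, s => by rw [loopM_cons₃, loopM_inp z, actM_inp]
/-- The handlers do not touch `u`. [folklore] -/
@[simp] theorem actM_u (a b d : Bool) (s : St) : (actM a b d s).u = s.u := by
  cases a <;> cases b <;> cases d <;> simp only [actM, hKHM, hKZM, hKCZM, hKCCZM, hKORM, cleanupM, commitM_u]
/-- The gate loop does not touch `u`. [folklore] -/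
@[simp] theorem loopM_u : ∀ (z : List Bool) (s : St), (loopM z s).u = s.u
  | [], _ => rfl
  | [_], _ => rfl
  | [_, _], _ => rfl
  | a :: b :: d :: z, s => by rw [loopM_cons₃, loopM_u z, actM_u]
/-- The handlers do not touch `u2`. [folklore] -/
@[simp] theorem actM_u2 (a b d : Bool) (s : St) : (actM a b d s).u2 = s.u2 := by
  cases a <;> cases b <;> cases d <;> simp only [actM, hKHM, hKZM, hKCZM, hKCCZM, hKORM, cleanupM, commitM_u2]
/-- The gate loop does not touch `u2`. [folklore] -/
@[simp] theorem loopM_u2 : ∀ (z : List Bool) (s : St), (loopM z s).u2 = s.u2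
  | [], _ => rfl
  | [_], _ => rfl
  | [_, _], _ => rfl
  | a :: b :: d :: z, s => by rw [loopM_cons₃, loopM_u2 z, actM_u2]
/-- The handlers do not touch `uc`. [folklore] -/
@[simp] theorem actM_uc (a b d : Bool) (s : St) : (actM a b d s).uc = s.uc := by
  cases a <;> cases b <;> cases d <;> simp only [actM, hKHM, hKZM, hKCZM, hKCCZM, hKORM, cleanupM, commitM_uc]
/-- The gate loop does not touch `uc`. [folklore] -/
@[simp] theorem loopM_uc : ∀ (z : List Bool) (s : St), (loopM z s).uc = s.uc
  | [], _ => rfl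
  | [_], _ => rfl
  | [_, _], _ => rfl
  | a :: b :: d :: z, s => by rw [loopM_cons₃, loopM_uc z, actM_uc]
/-- The handlers do not touch `d1`. [folklore] -/
@[simp] theorem actM_d1 (a b d : Bool) (s : St) : (actM a b d s).d1 = s.d1 := by
  cases a <;> cases b <;> cases d <;> simp only [actM, hKHM, hKZM, hKCZM, hKCCZM, hKORM, cleanupM, commitM_d1]
/-- The gate loop does not touch `d1`. [folklore] -/
@[simp] theorem loopM_d1 : ∀ (z : List Bool) (s : St), (loopM z s).d1 = s.d1
  | [], _ => rfl
  | [_], _ => rfl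
  | [_, _], _ => rfl
  | a :: b :: d :: z, s => by rw [loopM_cons₃, loopM_d1 z, actM_d1]
/-- The handlers do not touch `d2`. [folklore] -/
@[simp] theorem actM_d2 (a b d : Bool) (s : St) : (actM a b d s).d2 = s.d2 := by
  cases a <;> cases b <;> cases d <;> simp only [actM, hKHM, hKZM, hKCZM, hKCCZM, hKORM, cleanupM, commitM_d2]
/-- The gate loop does not touch `d2`. [folklore] -/
@[simp] theorem loopM_d2 : ∀ (z : List Bool) (s : St), (loopM z s).d2 = s.d2
  | [], _ => rfl
  | [_], _ => rfl
  | [_, _], _ => rfl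
  | a :: b :: d :: z, s => by rw [loopM_cons₃, loopM_d2 z, actM_d2]
/-- The handlers do not touch `nb`. [folklore] -/
@[simp] theorem actM_nb (a b d : Bool) (s : St) : (actM a b d s).nb = s.nb := by
  cases a <;> cases b <;> cases d <;> simp only [actM, hKHM, hKZM, hKCZM, hKCCZM, hKORM, cleanupM, commitM_nb]
/-- The gate loop does not touch `nb`. [folklore] -/
@[simp] theorem loopM_nb : ∀ (z : List Bool) (s : St), (loopM z s).nb = s.nb
  | [], _ => rfl
  | [_], _ => rfl
  | [_, _], _ => rfl
  | a :: b :: d :: z, s => by rw [loopM_cons₃, loopM_nb z, actM_nb]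
/-- The handlers do not touch `k`. [folklore] -/
@[simp] theorem actM_k (a b d : Bool) (s : St) : (actM a b d s).k = s.k := by
  cases a <;> cases b <;> cases d <;> simp only [actM, hKHM, hKZM, hKCZM, hKCCZM, hKORM, cleanupM, commitM_k]
/-- The gate loop does not touch `k`. [folklore] -/
@[simp] theorem loopM_k : ∀ (z : List Bool) (s : St), (loopM z s).k = s.k
  | [], _ => rfl
  | [_], _ => rfl
  | [_, _], _ => rfl
  | a :: b :: d :: z, s => by rw [loopM_cons₃, loopM_k z, actM_k]
/-- The handlers do not touch `ac`. [folklore] -/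
@[simp] theorem actM_ac (a b d : Bool) (s : St) : (actM a b d s).ac = s.ac := by
  cases a <;> cases b <;> cases d <;> simp only [actM, hKHM, hKZM, hKCZM, hKCCZM, hKORM, cleanupM, commitM_ac]
/-- The gate loop does not touch `ac`. [folklore] -/
@[simp] theorem loopM_ac : ∀ (z : List Bool) (s : St), (loopM z s).ac = s.ac
  | [], _ => rfl
  | [_], _ => rfl
  | [_, _], _ => rfl
  | a :: b :: d :: z, s => by rw [loopM_cons₃, loopM_ac z, actM_ac]
/-- The handlers do not touch `p0`. [folklore] -/
@[simp] theorem actM_p0 (a b d : Bool) (s : St) : (actM a b d s).p0 = s.p0 := by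
  cases a <;> cases b <;> cases d <;> simp only [actM, hKHM, hKZM, hKCZM, hKCCZM, hKORM, cleanupM, commitM_p0]
/-- The gate loop does not touch `p0`. [folklore] -/
@[simp] theorem loopM_p0 : ∀ (z : List Bool) (s : St), (loopM z s).p0 = s.p0
  | [], _ => rfl
  | [_], _ => rfl
  | [_, _], _ => rfl
  | a :: b :: d :: z, s => by rw [loopM_cons₃, loopM_p0 z, actM_p0]
/-- The handlers do not touch `p1`. [folklore] -/
@[simp] theorem actM_p1 (a b d : Bool) (s : St) : (actM a b d s).p1 = s.p1 := by
  cases a <;> cases b <;> cases d <;> simp only [actM, hKHM, hKZM, hKCZM, hKCCZM, hKORM, cleanupM, commitM_p1]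
/-- The gate loop does not touch `p1`. [folklore] -/
@[simp] theorem loopM_p1 : ∀ (z : List Bool) (s : St), (loopM z s).p1 = s.p1
  | [], _ => rfl
  | [_], _ => rfl
  | [_, _], _ => rfl
  | a :: b :: d :: z, s => by rw [loopM_cons₃, loopM_p1 z, actM_p1]
/-- The handlers do not touch `t`. [folklore] -/
@[simp] theorem actM_t (a b d : Bool) (s : St) : (actM a b d s).t = s.t := by
  cases a <;> cases b <;> cases d <;> simp only [actM, hKHM, hKZM, hKCZM, hKCCZM, hKORM, cleanupM, commitM_t]
/-- The gate loop does not touch `t`. [folklore] -/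
@[simp] theorem loopM_t : ∀ (z : List Bool) (s : St), (loopM z s).t = s.t
  | [], _ => rfl
  | [_], _ => rfl
  | [_, _], _ => rfl
  | a :: b :: d :: z, s => by rw [loopM_cons₃, loopM_t z, actM_t]
/-- The handlers do not touch `t2`. [folklore] -/
@[simp] theorem actM_t2 (a b d : Bool) (s : St) : (actM a b d s).t2 = s.t2 := by
  cases a <;> cases b <;> cases d <;> simp only [actM, hKHM, hKZM, hKCZM, hKCCZM, hKORM, cleanupM, commitM_t2]
/-- The gate loop does not touch `t2`. [folklore] -/
@[simp] theorem loopM_t2 : ∀ (z : List Bool) (s : St), (loopM z s).t2 = s.t2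
  | [], _ => rfl
  | [_], _ => rfl
  | [_, _], _ => rfl
  | a :: b :: d :: z, s => by rw [loopM_cons₃, loopM_t2 z, actM_t2]
/-- The handlers do not touch `c`. [folklore] -/
@[simp] theorem actM_c (a b d : Bool) (s : St) : (actM a b d s).c = s.c := by
  cases a <;> cases b <;> cases d <;> simp only [actM, hKHM, hKZM, hKCZM, hKCCZM, hKORM, cleanupM, commitM_c]
/-- The gate loop does not touch `c`. [folklore] -/
@[simp] theorem loopM_c : ∀ (z : List Bool) (s : St), (loopM z s).c = s.c
  | [], _ => rfl
  | [_], _ => rfl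
  | [_, _], _ => rfl
  | a :: b :: d :: z, s => by rw [loopM_cons₃, loopM_c z, actM_c]
/-- The handlers do not touch `res`. [folklore] -/
@[simp] theorem actM_res (a b d : Bool) (s : St) : (actM a b d s).res = s.res := by
  cases a <;> cases b <;> cases d <;> simp only [actM, hKHM, hKZM, hKCZM, hKCCZM, hKORM, cleanupM, commitM_res]
/-- The gate loop does not touch `res`. [folklore] -/
@[simp] theorem loopM_res : ∀ (z : List Bool) (s : St), (loopM z s).res = s.res
  | [], _ => rfl
  | [_], _ => rfl
  | [_, _], _ => rfl
  | a :: b :: d :: z, s => by rw [loopM_cons₃, loopM_res z, actM_res]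

/-- The invariant survives the gate loop. [folklore] -/
theorem inv_loopM {L : ℕ} : ∀ (z : List Bool) (s : St), Inv L s → s.g = z → Inv L (loopM z s)
  | [], s, hI, hg => by rw [loopM_nil, St.with_g_eq s hg]; exact hI
  | [_], s, hI, hg => by rw [loopM_one]; exact hI.of_g (by simp)
  | [_, _], s, hI, hg => by rw [loopM_two]; exact hI.of_g (by simp)
  | a :: b :: d :: z, s, hI, hg => by
    rw [loopM_cons₃]
    exact inv_loopM z _ (inv_actM a b d s z hI hg) (by rw [actM_g])

/-- A handler adds at most one Hadamard tally. [folklore] -/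
theorem actM_hu_le (a b d : Bool) (s : St) : (actM a b d s).hu.length ≤ s.hu.length + 1 := by
  cases a <;> cases b <;> cases d <;>
    first
    | (simp only [actM, hKHM, hKZM, hKCZM, hKCCZM, hKORM, cleanupM, List.length_cons]; omega)
    | (simp only [actM, commitM]; split_ifs <;> simp)

/-- A handler adds at most twelve shape tallies. [folklore] -/
theorem actM_ku_le (a b d : Bool) (s : St) : (actM a b d s).ku.length ≤ s.ku.length + 12 := by
  cases a <;> cases b <;> cases d <;>
    first
    | (simp only [actM, hKHM, hKZM, hKCZM, hKCCZM, hKORM, cleanupM, List.length_append, List.length_replicate,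
        List.length_cons, List.length_nil]; omega)
    | (simp only [actM, commitM]; split_ifs <;> simp)

/-- A handler prints at most `288 L + 1584` bits. [folklore] -/
theorem actM_o_le {L : ℕ} (a b d : Bool) (s : St) (hI : Inv L s) :
    (actM a b d s).o.length ≤ s.o.length + (288 * L + 1584) := by
  obtain ⟨-, -, -, -, hsz, hd1, hd2⟩ := hI
  cases a <;> cases b <;> cases d
  · simp [actM]
  · simp [actM]
  · simp only [actM, commitM]; split_ifs <;> simp
  · simp only [actM, hKORM, cleanupM, blockOR, List.length_append, List.length_reverse, length_codeNoneL]; omega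
  · simp only [actM, hKHM, cleanupM, List.length_append, List.length_reverse, length_blockH]; nlinarith
  · simp only [actM, hKZM, cleanupM, blockZ, List.length_append, List.length_reverse, length_codeNoneL, length_codeOneL]
    omega
  · simp only [actM, hKCZM, cleanupM, blockCZ, List.length_append, List.length_reverse, length_codeNoneL, length_codeTwoL]
    omega
  · simp only [actM, hKCCZM, cleanupM, blockCCZ, List.length_append, List.length_reverse, length_codeNoneL,
      length_codeThreeL]
    omega

/-- Sizes after the gate loop: Hadamard tallies. [folklore] -/
theorem loopM_hu_le : ∀ (z : List Bool) (s : St), (loopM z s).hu.length ≤ s.hu.length + z.length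
  | [], s => by simp [loopM_nil]
  | [_], s => by simp [loopM_one]
  | [_, _], s => by simp [loopM_two]
  | a :: b :: d :: z, s => by
    rw [loopM_cons₃]
    have h1 := loopM_hu_le z (actM a b d { s with g := z })
    have h2 := actM_hu_le a b d { s with g := z }
    simp only [List.length_cons] at *
    omega

/-- Sizes after the gate loop: shape tallies. [folklore] -/
theorem loopM_ku_le : ∀ (z : List Bool) (s : St), (loopM z s).ku.length ≤ s.ku.length + 12 * z.length
  | [], s => by simp [loopM_nil]
  | [_], s => by simp [loopM_one]
  | [_, _], s => by simp [loopM_two]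
  | a :: b :: d :: z, s => by
    rw [loopM_cons₃]
    have h1 := loopM_ku_le z (actM a b d { s with g := z })
    have h2 := actM_ku_le a b d { s with g := z }
    simp only [List.length_cons] at *
    omega

/-- Sizes after the gate loop: the printed body. [folklore] -/
theorem loopM_o_le {L : ℕ} : ∀ (z : List Bool) (s : St), Inv L s → s.g = z →
    (loopM z s).o.length ≤ s.o.length + z.length * (288 * L + 1584)
  | [], s, _, _ => by simp [loopM_nil]
  | [_], s, _, _ => by simp [loopM_one]
  | [_, _], s, _, _ => by simp [loopM_two]
  | a :: b :: d :: z, s, hI, hg => by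
    rw [loopM_cons₃]
    have hI' : Inv L { s with g := z } := hI.of_g (by rw [hg]; simp only [List.length_cons]; omega)
    have h1 := loopM_o_le z (actM a b d { s with g := z }) (inv_actM a b d s z hI hg) (by rw [actM_g])
    have h2 := actM_o_le a b d { s with g := z } hI'
    have h3 : (a :: b :: d :: z).length * (288 * L + 1584) = z.length * (288 * L + 1584) + 3 * (288 * L + 1584) := by
      simp only [List.length_cons]; ring
    simp only at h1 h2
    omega

/-! ### The whole program -/

/-- **The program**: prefix, parity and padding, dummies, gate loop, tail, header.
[cite: AaronsonAmbainis2018, §6 Thm. 25 (proof, p. 27)] -/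
def prog : Com R := (prefixLoop ;; parityLoop ;; padStep ;; mkDummies) ;; gateLoop ;; tailProg ;; headerProg

/-- The number of leading `1`s of a stream. [folklore] -/
def lead : List Bool → ℕ
  | true :: w => lead w + 1
  | _ => 0

/-- The stream after its first `0` (empty if there is none). [folklore] -/
def rest : List Bool → List Bool
  | true :: w => rest w
  | false :: w => w
  | [] => []

/-- `lead` and `rest` fit in the stream. [folklore] -/
theorem lead_add_length_rest_le : ∀ w : List Bool, lead w + (rest w).length ≤ w.length
  | true :: w => by have := lead_add_length_rest_le w; simp [lead, rest]; omega
  | false :: w => by simp [lead, rest]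
  | [] => by simp [lead, rest]

/-- On a lexed stream `lead` is the unary prefix. [folklore] -/
theorem lead_replicate (m : ℕ) (z : List Bool) : lead (List.replicate m true ++ false :: z) = m := by
  induction m with
  | zero => rfl
  | succ m ih => rw [List.replicate_succ, List.cons_append, lead, ih]

/-- On a lexed stream `rest` is the token stream. [folklore] -/
theorem rest_replicate (m : ℕ) (z : List Bool) : rest (List.replicate m true ++ false :: z) = z := by
  induction m with
  | zero => rfl
  | succ m ih => rw [List.replicate_succ, List.cons_append, rest, ih]

/-- The prefix model in closed form. [folklore] -/
theorem prefixM_eq : ∀ (w : List Bool) (s : St),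
    prefixM w s = { s with inp := [], u := List.replicate (lead w) true ++ s.u, g := rest w ++ s.g }
  | true :: w, s => by
    rw [prefixM, prefixM_eq w]
    simp [lead, rest, List.replicate_succ']
  | false :: w, s => by simp [prefixM, lead, rest]
  | [], s => by simp [prefixM, lead, rest]

/-- The padded count of logical wires: `n' = n + padCount n`. [cite: AaronsonAmbainis2018, §6 Thm. 25 (proof)] -/
def padded (n : ℕ) : ℕ := n + (bif decide (n % 2 = 1) then 0 else 1)

/-- `padded n = n + padCount n`. [folklore] -/
theorem padded_eq (n : ℕ) : padded n = n + padCount n := by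
  unfold padded padCount
  by_cases h : n % 2 = 1
  · simp [h]; omega
  · simp [h]; omega

/-- `padded n ≤ n + 1`. [folklore] -/
theorem padded_le (n : ℕ) : padded n ≤ n + 1 := by
  unfold padded; cases decide (n % 2 = 1) <;> simp

/-- The padding step produces the padded unary count. [folklore] -/
theorem pad_replicate (n : ℕ) :
    (bif decide (n % 2 = 1) then [] else [true]) ++ List.replicate n true = List.replicate (padded n) true := by
  unfold padded
  cases decide (n % 2 = 1) <;> simp [List.replicate_succ]

/-- The state entering the gate loop, for the input stream `z`: `n = lead z` in the padded unary
`u2`, the dummy numerals `n'`, `n' + 1`, `N = n' + 2`, and the token stream in `g`.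
[cite: AaronsonAmbainis2018, §6 Thm. 25 (proof)] -/
def preLoop (z : List Bool) : St :=
  { St.init z with
    inp := [], u := [], g := rest z
    u2 := List.replicate (padded (lead z)) true
    d1 := encodeNat (padded (lead z))
    d2 := encodeNat (padded (lead z) + 1)
    nb := encodeNat (padded (lead z) + 2) }

/-- **The functional model of the whole program.** [folklore] -/
def progM (z : List Bool) : St := headerM (tailM (loopM (rest z) (preLoop z)))

/-- **The string function computed by the program**: the result register of its model.
[cite: AaronsonAmbainis2018, §6 Thm. 25 (proof)] -/
def progFn (z : List Bool) : List Bool := (progM z).res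

/-- The first four phases reach `preLoop z`. [folklore] -/
theorem runs_preLoop (z : List Bool) :
    Runs (prefixLoop ;; parityLoop ;; padStep ;; mkDummies) (St.init z).regs (preLoop z).regs
      (9 * z.length + 5 + (6 * z.length + 1) + 6 + (9 * (z.length + 1) * (z.length + 1) + 100 * (z.length + 1) + 60)) := by
  have e1 := runs_prefixLoop z (St.init z) rfl rfl
  rw [prefixM_eq] at e1
  set n := lead z with hn
  set s1 : St := { St.init z with inp := [], u := List.replicate n true ++ (St.init z).u, g := rest z ++ (St.init z).g } with hs1
  have e2 := runs_parityLoop (List.replicate n true) s1 false (by simp [hs1, St.init]) rfl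
  simp only [List.length_replicate, Bool.false_xor] at e2
  set s2 : St := { s1 with u := [], p0 := flag (decide (n % 2 = 1)), u2 := List.replicate n true ++ s1.u2 } with hs2
  have e3 := runs_padStep s2 (decide (n % 2 = 1)) rfl
  set s3 : St := { s2 with p0 := [], u2 := (bif decide (n % 2 = 1) then [] else [true]) ++ s2.u2 } with hs3
  have hu2 : s3.u2 = List.replicate (padded n) true := by
    simp only [hs3, hs2, hs1, St.init, List.append_nil, pad_replicate]
  have e4 := runs_mkDummies s3 rfl rfl rfl rfl rfl rfl rfl
  rw [hu2, List.length_replicate] at e4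
  have hnz : n ≤ z.length := by have := lead_add_length_rest_le z; omega
  have hp := padded_le n
  refine (e1.seq (e2.seq (e3.seq e4))).of_eq ?_ ?_
  · simp only [hs3, hs2, hs1, preLoop, St.init, ← hn, List.append_nil, pad_replicate]
  · nlinarith [hnz, hp]

/-- The invariant holds when entering the gate loop, with `L = |z| + 2`. [folklore] -/
theorem inv_preLoop (z : List Bool) : Inv (z.length + 2) (preLoop z) := by
  have h1 := lead_add_length_rest_le z
  have h2 := padded_le (lead z)
  have h3 := TokConv.length_encodeNat_le (padded (lead z))
  have h4 := TokConv.length_encodeNat_le (padded (lead z) + 1)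
  refine ⟨rfl, isFlag_nil, isFlag_nil, isFlag_nil, ?_, ?_, ?_⟩ <;> simp [preLoop, St.init] <;> omega

/-- A polynomial step bound for the whole program. [folklore] -/
def progCost (ℓ : ℕ) : ℕ := 3000 * (ℓ + 2) * (ℓ + 2) * (ℓ + 2)

/-- **The whole program runs, on every input, to its model within `progCost |z|` steps.**
[folklore] -/
theorem runs_prog (z : List Bool) : Runs prog (St.init z).regs (progM z).regs (progCost z.length) := by
  have e1 := runs_preLoop z
  set s4 := preLoop z with hs4
  have hI := inv_preLoop z
  have e5 := runs_gateLoop (z.length + 2) (rest z) s4 hI rfl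
  set s5 := loopM (rest z) s4 with hs5
  have hI5 : Inv (z.length + 2) s5 := inv_loopM (rest z) s4 hI rfl
  have h5p0 : s5.p0 = [] := by rw [hs5, loopM_p0]; rfl
  have h5p1 : s5.p1 = [] := by rw [hs5, loopM_p1]; rfl
  have h5uc : s5.uc = [] := by rw [hs5, loopM_uc]; rfl
  have h5ac : s5.ac = [] := by rw [hs5, loopM_ac]; rfl
  have h5t2 : s5.t2 = [] := by rw [hs5, loopM_t2]; rfl
  have h5c : s5.c = [] := by rw [hs5, loopM_c]; rfl
  have h5k : s5.k = [] := by rw [hs5, loopM_k]; rfl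
  have h5u2 : s5.u2 = List.replicate (padded (lead z)) true := by rw [hs5, loopM_u2]; rfl
  have h5nb : s5.nb = encodeNat (padded (lead z) + 2) := by rw [hs5, loopM_nb]; rfl
  have e6 := runs_tailProg s5 h5p0 h5p1 h5uc h5ac hI5.ht h5t2 h5c
  set s6 := tailM s5 with hs6
  have e7 := runs_headerProg s6 (by rw [hs6]; exact h5k) (by rw [hs6]; exact hI5.ht) (by rw [hs6]; exact h5c)
    (by rw [hs6]; exact hI5.hfo)
  -- size facts
  have hlr := lead_add_length_rest_le z
  have hrest : (rest z).length ≤ z.length := by omega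
  have hpad : padded (lead z) ≤ z.length + 1 := by have := padded_le (lead z); omega
  have hu2 : s5.u2.length ≤ z.length + 1 := by rw [h5u2, List.length_replicate]; exact hpad
  have hhu : s5.hu.length ≤ z.length := by
    have := loopM_hu_le (rest z) s4
    rw [← hs5] at this
    have h0 : s4.hu.length = 0 := rfl
    omega
  have hku : s5.ku.length ≤ 12 * z.length := by
    have := loopM_ku_le (rest z) s4
    rw [← hs5] at this
    have h0 : s4.ku.length = 0 := rfl
    omega
  have ho : s5.o.length ≤ z.length * (288 * (z.length + 2) + 1584) := by
    have := loopM_o_le (rest z) s4 hI rfl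
    rw [← hs5] at this
    have h0 : s4.o.length = 0 := rfl
    have hm := Nat.mul_le_mul_right (288 * (z.length + 2) + 1584) hrest
    omega
  have hd1 : s5.d1.length ≤ z.length + 2 := hI5.hd1
  have hd2 : s5.d2.length ≤ z.length + 2 := hI5.hd2
  -- sizes after the tail
  have hku6 : s6.ku.length ≤ s5.ku.length + 12 * s5.u2.length + 7 := by
    rw [hs6]
    simp only [tailM, List.length_append, List.length_replicate, tailKu]
    cases (inc4F^[s5.hu.length] (false, false)).1 <;> cases finOf (qAfter s5.hu.length s5.u2.length) <;>
      simp only [cond_true, cond_false] <;> omega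
  have hnb6 : s6.nb.length ≤ z.length + 3 := by
    have : s6.nb = s5.nb := by rw [hs6]; rfl
    rw [this, h5nb]
    exact (TokConv.length_encodeNat_le _).trans (by omega)
  have hob : (oddBits s5.u2.length s5.d1 s5.d2).length ≤
      96 + (z.length + 1) * (96 * (z.length + 1) + 96 * (z.length + 2) + 96 * (z.length + 2) + 1584) := by
    simp only [oddBits, List.length_append, length_codeNoneL]
    have := length_oddBlocks_le s5.d1 s5.d2 0 s5.u2.length
    have hmono : s5.u2.length * (96 * (0 + s5.u2.length) + 96 * s5.d1.length + 96 * s5.d2.length + 1584) ≤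
        (z.length + 1) * (96 * (z.length + 1) + 96 * (z.length + 2) + 96 * (z.length + 2) + 1584) :=
      Nat.mul_le_mul hu2 (by omega)
    omega
  have hfb : (finBits s5.d1 s5.d2).length ≤ 48 + 3 * (32 * (z.length + 2) + 160) := by
    simp only [finBits, List.length_append, length_codeNoneL, length_codeTwoL]; omega
  have ho6 : s6.o.length ≤ s5.o.length + 48 + (oddBits s5.u2.length s5.d1 s5.d2).length + (finBits s5.d1 s5.d2).length := by
    rw [hs6]
    simp only [tailM, List.length_append, List.length_reverse, tailBits, length_codeNoneL]
    cases (inc4F^[s5.hu.length] (false, false)).1 <;> cases finOf (qAfter s5.hu.length s5.u2.length) <;>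
      simp only [cond_true, cond_false, List.length_nil] <;> omega
  -- the final arithmetic
  have htail : tailCost s5.u2.length s5.hu.length s5.d1.length s5.d2.length ≤
      240 + 13 * z.length + 40 * (z.length + 1) +
        (z.length + 1) * (141 * (z.length + 1) + 132 * (z.length + 2) + 132 * (z.length + 2) + 1643) +
        3 * (22 * (z.length + 2) + 22 * (z.length + 2) + 164) := by
    unfold tailCost
    have hmono : s5.u2.length * (141 * s5.u2.length + 132 * s5.d1.length + 132 * s5.d2.length + 1643) ≤
        (z.length + 1) * (141 * (z.length + 1) + 132 * (z.length + 2) + 132 * (z.length + 2) + 1643) :=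
      Nat.mul_le_mul hu2 (by omega)
    omega
  have hK : s6.ku.length ≤ 24 * z.length + 19 := by omega
  have hO : s6.o.length ≤ z.length * (288 * (z.length + 2) + 1584) + 48 +
      (96 + (z.length + 1) * (96 * (z.length + 1) + 96 * (z.length + 2) + 96 * (z.length + 2) + 1584)) +
      (48 + 3 * (32 * (z.length + 2) + 160)) := by omega
  have hhead : headerCost s6.ku.length s6.o.length s6.nb.length ≤
      (24 * z.length + 19) * (9 * (24 * z.length + 19) + 11) + 7 * (24 * z.length + 19) +
        3 * (z.length * (288 * (z.length + 2) + 1584) + 48 +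
          (96 + (z.length + 1) * (96 * (z.length + 1) + 96 * (z.length + 2) + 96 * (z.length + 2) + 1584)) +
          (48 + 3 * (32 * (z.length + 2) + 160))) + 7 * (z.length + 3) + 20 := by
    unfold headerCost
    have hmono : s6.ku.length * (9 * s6.ku.length + 11) ≤ (24 * z.length + 19) * (9 * (24 * z.length + 19) + 11) :=
      Nat.mul_le_mul hK (by omega)
    omega
  have hgate : (rest z).length * (404 * (z.length + 2) + 1656) + 7 ≤ z.length * (404 * (z.length + 2) + 1656) + 7 :=
    Nat.add_le_add_right (Nat.mul_le_mul_right _ hrest) 7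
  refine (e1.seq (e5.seq (e6.seq e7))).mono ?_
  unfold progCost
  nlinarith [htail, hhead, hgate]

/-- **The instance-map program computes an `FP` function.** [cite: AaronsonAmbainis2018, §6 Thm. 25 ("polynomial-time reducible")] -/
theorem progFn_mem_FP : progFn ∈ FP := by
  refine Com.mem_FP prog R.inp R.res (3000 * (Polynomial.X + 2) ^ 3) progFn fun z => ⟨(progM z).regs, Or.inl ?_, rfl⟩
  rw [St.regs_init]
  refine (runs_prog z).mono (le_of_eq ?_)
  simp [progCost, Polynomial.eval_mul, Polynomial.eval_pow]
  ring

end Thm25Asm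

end Literature.Computability.QuantumComplexity
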